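import Mathlib
import Summits.Ventures.PercRepro2.GradedSP
import Summits.Ventures.PercRepro2.UniversalDoubling

/-! # (UH*) on every series–parallel network in series with a two-edge bundle
(seat mine-b, cell pub-perc-repro2; MINE-B.md §22.2, §22.5)

`SP.graded` (GradedSP.lean) gives every series–parallel network the hypotheses of `universal_doubling`
(`G_1`, `V2_2`, the level Harris inequalities), so for every `s : SP` the network `s ∧ (free ∗ free)` — `s`
in series with the bundle of two parallel free edges — satisfies the universal level-conditioned Hall
statement (UH*): every configuration with red flow `0` and blue flow `a ≥ 1` owns `a` private
sub-configurations with red flow exactly `1` and blue flow `≥ a − 1`.  The labels of the SP term are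
definitionally the product labels `dR`, `dB` of UniversalDoubling.lean. -/

namespace Summit.Ventures.PercRepro2.V2Closure

open UHClosure

/-- the bundle of two parallel free edges as a series–parallel term -/
abbrev SP.bundle2 : SP := SP.par SP.free SP.free

/-- the labels of `s ∧ bundle2` are the product labels of UniversalDoubling.lean -/
theorem SP.rLab_ser_bundle2 (s : SP) : (SP.ser s SP.bundle2).rLab = dR s.rLab := rfl

/-- the labels of `s ∧ bundle2` are the product labels of UniversalDoubling.lean -/
theorem SP.bLab_ser_bundle2 (s : SP) : (SP.ser s SP.bundle2).bLab = dB s.bLab := rfl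

/-- **(UH*) survives the doubling of a leaf in the critical context, on every series–parallel network**:
`s ∧ (free ∗ free)` satisfies the universal level-conditioned Hall statement. -/
theorem SP.universal_ser_bundle2 (s : SP) : Universal (SP.ser s SP.bundle2).rLab (SP.ser s SP.bundle2).bLab :=
  universal_doubling s.rLab s.bLab (SP.gDom 1 s) (SP.vDom 2 le_rfl s) (SP.graded s).2.1

end Summit.Ventures.PercRepro2.V2Closure
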